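import Summits.AtomisticToContinuum.BoseEinsteinCondensation.Theorems.LatticeToPeriodicBridge.Negative.WindowedBridge
import Summits.AtomisticToContinuum.BoseEinsteinCondensation.Theorems.LatticeToPeriodicBridge.Negative.UniformThreshold
import Summits.AtomisticToContinuum.BoseEinsteinCondensation.Theorems.LatticeToPeriodicBridge.Negative.ScalingReduction

/-!
# Strategist sketch — crux stmt-AtomisticToContinuum-9674 `LatticeToPeriodicBridge` (A → B)

Typed companions of `STRATEGY-CENSUS.md` (crux-strategist / wall-breaker seat, 2026-08-17).
Every statement here is a lens ATTEMPT, kernel-checked where an implication is claimed; none is a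
registered line (see the census for why each gives no leverage).

* §S  STRENGTHEN — `EndpointComparison` (`S⁺_κ`, the comparison of the two order parameters at a
  matched pair (continuum torus at density `ρ`, hard-core lattice torus `(ℤ/Mℤ)³` at filling
  `N/M³ ∈ [1/16, 1/2]`) up to a universal factor `κ`) and its loose form; `crux_of_endpointComparison`
  (S⁺ consumes A and closes the crux) and `loose_of_uniformFloor` (the loose S⁺ is implied by a
  v-UNIFORM condensate floor plus the trivial lattice ceiling — the "B in costume" sandwich, now typed
  for the endpoint form itself rather than for one line's stub).
* §D  DECOMPOSITION — the potential-class split `CruxHardSpheres ∧ HardSpheresWorstCase → crux`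
  (`crux_of_hardSphereSplit`), typed over `hardCorePotential` and the landed scaling reduction.
* §N  NEGATION — `negation_needs_badUnitRangePotential`: a counterexample is a proof of A plus an
  admissible UNIT-RANGE potential without torus BEC at small density.
-/

noncomputable section

namespace Summit.AtomisticToContinuum.BoseEinsteinCondensation.Cruxes.LatticeToPeriodicBridge.Strategist

open Literature.MathematicalPhysics.QuantumManyBody.BoseGas
open Literature.MathematicalPhysics.QuantumLattice
open _root_.MeasureTheory _root_.Filter _root_.Topology
open scoped ENNReal NNReal
open Summit.AtomisticToContinuum.BoseEinsteinCondensation.Theses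
open Summit.AtomisticToContinuum.BoseEinsteinCondensation.Theses.BECStronglyRayleigh
open Summit.AtomisticToContinuum.BoseEinsteinCondensation.Theorems.LatticeToPeriodicBridge.Negative

/-- `⟨S⁺_tot S⁻_tot⟩` of the sector-`N` ground state of hard-core bosons on `(ℤ/Mℤ)³` (= `M³ ×` the
zero-mode occupation): verbatim the right-hand side of `KineticLatticeBEC` at `(M, N)`. -/
def latticeZeroMode (M N : ℕ) [NeZero M] : ℝ :=
  ((xyTorus 3 M 1 + (((3 + 1) * M ^ 3 : ℕ) : ℂ) •
      (totalSpin 1 2 + ((M : ℂ) ^ 3 / 2 - (N : ℂ)) • 1) ^ 2).groundStateFunctional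
      (totalSpin 1 0 * totalSpin 1 0 + totalSpin 1 1 * totalSpin 1 1)).re + N - (M : ℝ) ^ 3 / 2

/-- The antecedent, read through `latticeZeroMode` (definitional). -/
theorem kinetic_iff :
    KineticLatticeBEC ↔ ∃ c : ℝ, 0 < c ∧ ∃ L₀ : ℕ, ∀ (L : ℕ) [NeZero L], L₀ ≤ L → Even L →
      ∀ N : ℕ, 1 ≤ N → 2 * N ≤ L ^ 3 → c * N * (L : ℝ) ^ 3 ≤ latticeZeroMode L N :=
  Iff.rfl

/-! ## §S Strengthen: the endpoint comparison -/

/-- **S⁺ (EndpointComparison, windowed).** For every admissible `v`, at all small densities, there is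
a universal factor `κ > 0` such that for all large `N` every near-minimiser of the continuum torus gas
carries at least `κ ×` the zero-mode occupation of the hard-core lattice gas with the same `N` on an
even torus `(ℤ/Mℤ)³` of comparable filling (`2N ≤ M³ ≤ 32N`, `M ≥ M₀` arbitrary). With A this closes
the crux (`crux_of_endpointComparison`); without an engine it is a comparison of two order parameters
of two different gapless ground states (census §Strengthen). -/
def EndpointComparison : Prop :=
  ∀ v : ℝ → ℝ≥0∞, IsRepulsiveFiniteRange v → ∃ ρ₀ : ℝ, 0 < ρ₀ ∧ ∀ ρ : ℝ, 0 < ρ → ρ < ρ₀ →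
    ∃ κ : ℝ, 0 < κ ∧ ∀ M₀ : ℕ, ∀ᶠ N : ℕ in atTop, ∃ δ : ℝ≥0∞, 0 < δ ∧
      ∃ M : ℕ, ∃ _ : NeZero M, M₀ ≤ M ∧ Even M ∧ 2 * N ≤ M ^ 3 ∧ M ^ 3 ≤ 32 * N ∧
        ∀ Ψ : PeriodicTrialState N (sideLength ρ N),
          periodicEnergy v Ψ ≤ periodicGroundStateEnergy v N (sideLength ρ N) + δ →
            ENNReal.ofReal (κ / (M : ℝ) ^ 3 * latticeZeroMode M N) ≤
              condensateOccupation N (sideLength ρ N) Ψ.ψ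

/-- **S⁺ loose** — the same without the filling window (any even `M ≥ M₀` with `2N ≤ M³`). -/
def EndpointComparisonLoose : Prop :=
  ∀ v : ℝ → ℝ≥0∞, IsRepulsiveFiniteRange v → ∃ ρ₀ : ℝ, 0 < ρ₀ ∧ ∀ ρ : ℝ, 0 < ρ → ρ < ρ₀ →
    ∃ κ : ℝ, 0 < κ ∧ ∀ M₀ : ℕ, ∀ᶠ N : ℕ in atTop, ∃ δ : ℝ≥0∞, 0 < δ ∧
      ∃ M : ℕ, ∃ _ : NeZero M, M₀ ≤ M ∧ Even M ∧ 2 * N ≤ M ^ 3 ∧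
        ∀ Ψ : PeriodicTrialState N (sideLength ρ N),
          periodicEnergy v Ψ ≤ periodicGroundStateEnergy v N (sideLength ρ N) + δ →
            ENNReal.ofReal (κ / (M : ℝ) ^ 3 * latticeZeroMode M N) ≤
              condensateOccupation N (sideLength ρ N) Ψ.ψ

theorem loose_of_endpointComparison (h : EndpointComparison) : EndpointComparisonLoose := by
  intro v hv
  obtain ⟨ρ₀, hρ₀, hρ⟩ := h v hv
  refine ⟨ρ₀, hρ₀, fun ρ h1 h2 => ?_⟩
  obtain ⟨κ, hκ, hM₀⟩ := hρ ρ h1 h2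
  refine ⟨κ, hκ, fun M₀ => ?_⟩
  filter_upwards [hM₀ M₀] with N hN
  obtain ⟨δ, hδ, M, hM, hM₀M, hE, h2N, -, hΨ⟩ := hN
  exact ⟨δ, hδ, M, hM, hM₀M, hE, h2N, hΨ⟩

/-- **The loose endpoint comparison consumes A and closes the crux** (pure bookkeeping). -/
theorem crux_of_endpointComparisonLoose (hS : EndpointComparisonLoose) : LatticeToPeriodicBridge := by
  intro hA v hv
  obtain ⟨c, hc, L₀, hAL⟩ := hA
  obtain ⟨ρ₀, hρ₀, hρ⟩ := hS v hv
  refine ⟨ρ₀, hρ₀, fun ρ hρpos hρlt => ?_⟩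
  obtain ⟨κ, hκ, hM₀⟩ := hρ ρ hρpos hρlt
  refine ⟨κ * c, mul_pos hκ hc, ?_⟩
  filter_upwards [hM₀ L₀, eventually_ge_atTop 1] with N hN hN1
  obtain ⟨δ, hδ, M, hM, hL₀M, hEven, h2N, hΨ⟩ := hN
  refine ⟨δ, hδ, fun Ψ hE => le_trans ?_ (hΨ Ψ hE)⟩
  have hlat : c * N * (M : ℝ) ^ 3 ≤ latticeZeroMode M N := hAL M hL₀M hEven N hN1 h2N
  apply ENNReal.ofReal_le_ofReal
  have hM0 : (M : ℝ) ≠ 0 := by exact_mod_cast (NeZero.ne M)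
  have hM3 : (0 : ℝ) < (M : ℝ) ^ 3 := by positivity
  calc κ * c * (N : ℝ) = κ / (M : ℝ) ^ 3 * (c * N * (M : ℝ) ^ 3) := by
        field_simp
    _ ≤ κ / (M : ℝ) ^ 3 * latticeZeroMode M N :=
        mul_le_mul_of_nonneg_left hlat (by positivity)

/-- **S⁺ consumes A and closes the crux.** -/
theorem crux_of_endpointComparison (hS : EndpointComparison) : LatticeToPeriodicBridge :=
  crux_of_endpointComparisonLoose (loose_of_endpointComparison hS)

/-- The trivial lattice ceiling `⟨S⁺_tot S⁻_tot⟩ ≤ N·M³` (zero-mode occupation `≤ N`; Tóth's bound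
`N(M³−N+1)` is sharper). Finite-dimensional; left as a named hypothesis here. -/
def LatticeCeiling : Prop :=
  ∀ (M : ℕ) [NeZero M] (N : ℕ), 2 * N ≤ M ^ 3 → latticeZeroMode M N ≤ N * (M : ℝ) ^ 3

/-- A `v`-UNIFORM torus condensate floor `θ` (formally stronger than B, which lets `c` depend on
`(v, ρ)`; believed true — complete BEC in the dilute limit). -/
def UniformFloor (θ : ℝ) : Prop :=
  ∀ v : ℝ → ℝ≥0∞, IsRepulsiveFiniteRange v → ∃ ρ₀ : ℝ, 0 < ρ₀ ∧ ∀ ρ : ℝ, 0 < ρ → ρ < ρ₀ →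
    ∀ᶠ N : ℕ in atTop, ∃ δ : ℝ≥0∞, 0 < δ ∧ ∀ Ψ : PeriodicTrialState N (sideLength ρ N),
      periodicEnergy v Ψ ≤ periodicGroundStateEnergy v N (sideLength ρ N) + δ →
        ENNReal.ofReal (θ * N) ≤ condensateOccupation N (sideLength ρ N) Ψ.ψ

/-- **The costume direction, typed**: a uniform floor plus the trivial lattice ceiling already give
the loose endpoint comparison (with `κ = θ`), the lattice playing no role. So `S⁺` is sandwiched
between two forms of the consequent (`UniformFloor θ ⟹ S⁺_loose ⟹ (A → B)`), exactly like the
residual stubs of the two dead lines — the sandwich is a property of the endpoint FORM, not of a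
particular line. -/
theorem loose_of_uniformFloor (hC : LatticeCeiling) {θ : ℝ} (hθ : 0 < θ) (hF : UniformFloor θ) :
    EndpointComparisonLoose := by
  intro v hv
  obtain ⟨ρ₀, hρ₀, hρ⟩ := hF v hv
  refine ⟨ρ₀, hρ₀, fun ρ h1 h2 => ⟨θ, hθ, fun M₀ => ?_⟩⟩
  filter_upwards [hρ ρ h1 h2] with N hN
  obtain ⟨δ, hδ, hΨ⟩ := hN
  -- the lattice size: any even `M ≥ M₀` with `2N ≤ M³`
  set M : ℕ := 2 * (N + M₀ + 1) with hMdef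
  have hMpos : 0 < M := by omega
  haveI hMne : NeZero M := ⟨hMpos.ne'⟩
  have hM₀M : M₀ ≤ M := by omega
  have hEven : Even M := ⟨N + M₀ + 1, by omega⟩
  have h2N : 2 * N ≤ M ^ 3 := by
    calc 2 * N ≤ M := by omega
      _ ≤ M ^ 3 := Nat.le_self_pow (by norm_num) M
  refine ⟨δ, hδ, M, hMne, hM₀M, hEven, h2N, fun Ψ hE => le_trans ?_ (hΨ Ψ hE)⟩
  apply ENNReal.ofReal_le_ofReal
  have hM0 : (M : ℝ) ≠ 0 := by exact_mod_cast hMpos.ne'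
  have hM3 : (0 : ℝ) < (M : ℝ) ^ 3 := by positivity
  have hceil : latticeZeroMode M N ≤ N * (M : ℝ) ^ 3 := hC M N h2N
  calc θ / (M : ℝ) ^ 3 * latticeZeroMode M N ≤ θ / (M : ℝ) ^ 3 * (N * (M : ℝ) ^ 3) :=
        mul_le_mul_of_nonneg_left hceil (by positivity)
    _ = θ * N := by field_simp

/-! ## §D Decomposition: the potential-class split -/

/-- `Sub₁`: the crux for the unit hard-sphere gas alone. -/
def CruxHardSpheres : Prop :=
  KineticLatticeBEC → ConsequentAt (hardCorePotential 1)

/-- `Sub₂` (**hard spheres are the worst case**): for every admissible `v` some hard-sphere gas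
condenses only if `v` does (intended `a = R₀(v)`: `v ≤ hardCorePotential R₀` pointwise, smaller
scattering length, "less depletion"). An order-parameter comparison between two open statements —
the same species as the crux. -/
def HardSpheresWorstCase : Prop :=
  ∀ v : ℝ → ℝ≥0∞, IsRepulsiveFiniteRange v →
    ∃ a : ℝ, 0 < a ∧ (ConsequentAt (hardCorePotential a) → ConsequentAt v)

/-- **Glue of the potential-class split** (kernel-checked; uses the landed exact dilation
covariance `ConsequentAt (hardCorePotential a) ↔ ConsequentAt (hardCorePotential 1)`). -/
theorem crux_of_hardSphereSplit (h₁ : CruxHardSpheres) (h₂ : HardSpheresWorstCase) :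
    LatticeToPeriodicBridge := by
  intro hA v hv
  obtain ⟨a, ha, himp⟩ := h₂ v hv
  refine himp ?_
  have h1 : ConsequentAt (hardCorePotential 1) := h₁ hA
  have := consequentAt_scaledPotential ha h1
  rwa [scaledPotential_hardCorePotential_one ha] at this

/-- Conversely the split loses nothing: the crux gives `Sub₁`, and B gives `Sub₂`. -/
theorem cruxHardSpheres_of_crux (h : LatticeToPeriodicBridge) : CruxHardSpheres :=
  fun hA => h hA _ (isRepulsiveFiniteRange_hardCorePotential 1)

theorem hardSpheresWorstCase_of_periodicBEC (h : BECPeriodicReduction.PeriodicBEC) :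
    HardSpheresWorstCase :=
  fun v hv => ⟨1, one_pos, fun _ => h v hv⟩

/-! ## §N Negation -/

/-- **What a counterexample is** (unit-range normal form): a proof of the lattice target together
with an admissible potential of range `≤ 1` whose dilute torus gas does not condense. -/
theorem negation_needs_badUnitRangePotential (h : ¬ LatticeToPeriodicBridge) :
    KineticLatticeBEC ∧
      ∃ v : ℝ → ℝ≥0∞, IsRepulsiveFiniteRange v ∧ (∀ r, 1 < r → v r = 0) ∧ ¬ ConsequentAt v := by
  rw [crux_iff_unitRange] at h
  push Not at h
  obtain ⟨hA, v, hv, h1, hbad⟩ := h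
  exact ⟨hA, v, hv, h1, hbad⟩

end Summit.AtomisticToContinuum.BoseEinsteinCondensation.Cruxes.LatticeToPeriodicBridge.Strategist

end
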